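import Literature.Algebra.Homology.KInjectiveAdjunction
import Mathlib.CategoryTheory.Shift.ShiftedHom
import HarnessLib

/-!
# Naturality of the derived adjunction on the K-injective model:
# `shiftedHomLinearEquivOfAdjunction` transposes shifted Homs, respects composition and the counit

Topic `Algebra/Homology`; namespace `Literature.Algebra.Homology`. Pure homological algebra; everything
proved, no named fact. Sequel to `KInjectiveAdjunction.lean`.

For an adjunction `G ⊣ H` whose right adjoint commutes with a shift, the **transpose of a shifted Hom**
`x : G X ⟶ Y⟦a⟧` is `x♭ := η_X ≫ H x ≫ (H commutes with ⟦a⟧) : X ⟶ (H Y)⟦a⟧` (`ShiftedHom.transpose`).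
It is natural in `X` (`transpose_mk₀_comp`), multiplicative for Mathlib's composition of shifted Homs
(`transpose_comp`: `(x · w)♭ = x♭ · (ε · w)♭`) and normalised (`transpose_mk₀_counit`: `ε♭ = 𝟙`) — the
three identities Mac Lane IV.1 Thm. 1 (ii) asks of an adjunction, in shifted form.

For `L ⊣ R` additive between abelian categories with `L` preserving monomorphisms and `J` a bounded-below
complex of injectives, the equivalence
`Ψ = shiftedHomLinearEquivOfAdjunction adj M J a k : Hom_D(Q(L M), (Q J)⟦k⟧) ≃ₗ Hom_D(Q M, (Q(R J))⟦k⟧)`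
of `KInjectiveAdjunction.lean` IS this transpose read through `Q`:
**`Ψ (x̃.map Q) = (x̃♭).map Q`** for every chain-level `x̃ : L M ⟶ J⟦k⟧` (`shiftedHomLinearEquivOfAdjunction_map`),
and every derived `x` is such an `x̃.map Q` (`exists_map_Q_eq`, K-injectivity of `J⟦k⟧`). Hence the three
laws of the NODE «derived adjoint pair» (Road №4 of the Hodge atlas, `IsogenyDerivedAdjointPair`,
stmt-HodgeConjecture-26512) hold for `Ψ`:
* `shiftedHomLinearEquivOfAdjunction_mk₀_comp` — naturality in `M` for chain maps: `Ψ ([Q(L f)] · x) = [Q f] · Ψ x`;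
* `shiftedHomLinearEquivOfAdjunction_comp` — `Ψ (z · w) = Ψ z · Ψ ([Q ε_J] · w)` for derived classes
  `z : Q(L K') ⟶ (Q J)⟦a⟧`, `w : Q J ⟶ (Q J')⟦b⟧` (`J, J'` bounded-below injective);
* `shiftedHomLinearEquivOfAdjunction_mk₀_counit` — `Ψ [Q ε_J] = [𝟙]`.

## References
* S. Mac Lane, *Categories for the Working Mathematician*, IV.1 Thm. 1 (context).
* J. Lipman, *Notes on derived functors and Grothendieck duality*, LNM 1960 (2009), Prop. 3.2.3. [Lipman2009]
* C. A. Weibel, *An introduction to homological algebra* (1994), §10.4. [Weibel1994]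
-/

noncomputable section

-- compositions through `(F ⋙ G).obj X = G.obj (F.obj X)` / `(𝟭 C).obj X = X` (as in Mathlib's `Shift/Adjunction.lean`)
set_option backward.isDefEq.respectTransparency false

open CategoryTheory CategoryTheory.Limits CategoryTheory.Category

namespace Literature.Algebra.Homology

universe w w' v v' u u'

/-! ### The transpose of a shifted Hom along an adjunction -/

section Transpose

variable {C : Type u} [Category.{v} C] {D : Type u'} [Category.{v'} D] {A : Type*} [AddMonoid A]
  [HasShift C A] [HasShift D A] {G : C ⥤ D} {H : D ⥤ C} (adj : G ⊣ H) [H.CommShift A]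

/-- **The transpose of a shifted Hom** `x : G X ⟶ Y⟦a⟧` along `G ⊣ H` with `H` commuting with the shift:
`x♭ := adj.homEquiv x ≫ (H ⋘ ⟦a⟧ ≅ ⟦a⟧ ⋘ H)_Y : X ⟶ (H Y)⟦a⟧`. [cite: Weibel1994, §10.4] -/
def ShiftedHom.transpose {X : C} {Y : D} {a : A} (x : ShiftedHom (G.obj X) Y a) :
    ShiftedHom X (H.obj Y) a :=
  adj.homEquiv _ _ x ≫ (H.commShiftIso a).hom.app Y

/-- `x♭ = η_X ≫ x.map H` (Mathlib `ShiftedHom.map`). [cite: Weibel1994, §10.4] -/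
theorem ShiftedHom.transpose_eq {X : C} {Y : D} {a : A} (x : ShiftedHom (G.obj X) Y a) :
    ShiftedHom.transpose adj x = (adj.unit.app X : X ⟶ H.obj (G.obj X)) ≫ x.map H := by
  simp only [ShiftedHom.transpose, CategoryTheory.Adjunction.homEquiv_unit, ShiftedHom.map, assoc]

/-- A morphism precomposed to a composition of shifted Homs. [cite: Weibel1994, §10.4] -/
theorem ShiftedHom.precomp_comp {X X' Y Z : C} {a b c : A} (u : X' ⟶ X) (f : ShiftedHom X Y a)
    (g : ShiftedHom Y Z b) (h : b + a = c) :
    (ShiftedHom.comp (u ≫ f : ShiftedHom X' Y a) g h) = u ≫ f.comp g h := by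
  simp only [ShiftedHom.comp, assoc]

/-- Post-composition by a shifted morphism passes inside a composition of shifted Homs. [cite: Weibel1994, §10.4] -/
theorem ShiftedHom.comp_postcomp {X Y Z Z' : C} {a b c : A} (f : ShiftedHom X Y a) (g : ShiftedHom Y Z b)
    (v : Z ⟶ Z') (h : b + a = c) :
    f.comp (g ≫ v⟦b⟧' : ShiftedHom Y Z' b) h = f.comp g h ≫ v⟦c⟧' := by
  simp only [ShiftedHom.comp, Functor.map_comp, assoc]
  congr 2
  exact (shiftFunctorAdd' C b a c h).inv.naturality v

/-- A shifted morphism in the middle of a composition of shifted Homs moves to the second factor. [cite: Weibel1994, §10.4] -/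
theorem ShiftedHom.comp_shift_comp {X Y Y' Z : C} {a b c : A} (f : ShiftedHom X Y a) (u : Y ⟶ Y')
    (g : ShiftedHom Y' Z b) (h : b + a = c) :
    ShiftedHom.comp (f ≫ u⟦a⟧' : ShiftedHom X Y' a) g h = f.comp (u ≫ g : ShiftedHom Y Z b) h := by
  simp only [ShiftedHom.comp, Functor.map_comp, assoc]

/-- A degree-`0` class followed by a degree-`0` shifted morphism. [cite: Weibel1994, §10.4] -/
theorem ShiftedHom.mk₀_comp_shift_map {X Y Z : C} (f : X ⟶ Y) (g : Y ⟶ Z) :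
    (ShiftedHom.mk₀ (0 : A) rfl f : ShiftedHom X Y (0 : A)) ≫ g⟦(0 : A)⟧' =
      ShiftedHom.mk₀ (0 : A) rfl (f ≫ g) := by
  simp only [ShiftedHom.mk₀, assoc]
  congr 1
  exact ((shiftFunctorZero' C (0 : A) rfl).inv.naturality g).symm

/-- A morphism followed by a degree-`0` class. [cite: Weibel1994, §10.4] -/
theorem ShiftedHom.mk₀_precomp {X Y Z : C} (f : X ⟶ Y) (g : Y ⟶ Z) :
    ShiftedHom.mk₀ (0 : A) rfl (f ≫ g) = f ≫ (ShiftedHom.mk₀ (0 : A) rfl g : ShiftedHom Y Z (0 : A)) := by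
  simp only [ShiftedHom.mk₀, assoc]

/-- **Naturality of the transpose in the first variable** (for morphisms `f : X' ⟶ X`):
`((G f) · x)♭ = f · x♭`. [cite: Weibel1994, §10.4] -/
theorem ShiftedHom.transpose_mk₀_comp {X X' : C} {Y : D} {a : A} (f : X' ⟶ X)
    (x : ShiftedHom (G.obj X) Y a) :
    ShiftedHom.transpose adj ((ShiftedHom.mk₀ (0 : A) rfl (G.map f)).comp x (add_zero a)) =
      (ShiftedHom.mk₀ (0 : A) rfl f).comp (ShiftedHom.transpose adj x) (add_zero a) := by
  rw [ShiftedHom.transpose_eq, ShiftedHom.transpose_eq, ShiftedHom.map_comp, ShiftedHom.map_mk₀,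
    ShiftedHom.mk₀_comp, ShiftedHom.mk₀_comp]
  have hn := adj.unit.naturality f
  dsimp at hn
  rw [← assoc, ← hn, assoc]

/-- **The transpose of the counit is the identity**: `(ε_Y)♭ = 𝟙_{H Y}` (as degree-`0` shifted Homs).
[cite: Weibel1994, §10.4] -/
theorem ShiftedHom.transpose_mk₀_counit (Y : D) :
    ShiftedHom.transpose adj (ShiftedHom.mk₀ (X := G.obj (H.obj Y)) (Y := Y) (0 : A) rfl (adj.counit.app Y)) =
      ShiftedHom.mk₀ (0 : A) rfl (𝟙 (H.obj Y)) := by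
  rw [ShiftedHom.transpose_eq, ShiftedHom.map_mk₀]
  simp only [ShiftedHom.mk₀, Functor.id_obj, id_comp,
    CategoryTheory.Adjunction.right_triangle_components_assoc]

/-- **The transpose is multiplicative**: `(x · w)♭ = x♭ · (ε_Y · w)♭` for `x : G X ⟶ Y⟦a⟧`,
`w : Y ⟶ Y'⟦b⟧`. [cite: Weibel1994, §10.4] -/
theorem ShiftedHom.transpose_comp {X : C} {Y Y' : D} {a b c : A} (x : ShiftedHom (G.obj X) Y a)
    (w : ShiftedHom Y Y' b) (h : b + a = c) :
    ShiftedHom.transpose adj (x.comp w h) =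
      (ShiftedHom.transpose adj x).comp
        (ShiftedHom.transpose adj ((ShiftedHom.mk₀ (X := G.obj (H.obj Y)) (Y := Y) (0 : A) rfl
          (adj.counit.app Y)).comp w (add_zero b))) h := by
  rw [ShiftedHom.transpose_eq, ShiftedHom.transpose_eq, ShiftedHom.transpose_eq, ShiftedHom.map_comp,
    ShiftedHom.map_comp, ShiftedHom.map_mk₀, ShiftedHom.mk₀_comp, ShiftedHom.precomp_comp]
  congr 1
  simp only [Functor.id_obj, CategoryTheory.Adjunction.right_triangle_components_assoc]

end Transpose

/-! ### `shiftedHomLinearEquivOfAdjunction` is the transpose read through `Q` -/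

section KInjective

variable {𝕜 : Type*} [Ring 𝕜] {C : Type u} [Category.{v} C] [Abelian C] [Linear 𝕜 C]
  {D : Type u'} [Category.{v'} D] [Abelian D] [Linear 𝕜 D]
  [HasDerivedCategory.{w} C] [HasDerivedCategory.{w'} D]
  {L : C ⥤ D} {R : D ⥤ C} (adj : L ⊣ R) [L.Additive] [R.Additive] [R.Linear 𝕜] [L.PreservesMonomorphisms]

/-- `shiftedHomQLinearEquiv` unfolded. [cite: Spaltenstein1988, Prop. 1.5] -/
theorem shiftedHomQLinearEquiv_apply {E : Type u} [Category.{v} E] [Abelian E] [Linear 𝕜 E]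
    [HasDerivedCategory.{w} E] (X Y : CochainComplex E ℤ) (k : ℤ)
    (x : ShiftedHom (DerivedCategory.Q.obj X) (DerivedCategory.Q.obj Y) k) :
    shiftedHomQLinearEquiv (𝕜 := 𝕜) X Y k x = x ≫ (DerivedCategory.Q.commShiftIso k).inv.app Y := by
  simp only [shiftedHomQLinearEquiv, Linear.homCongr_apply, Iso.refl_inv, Iso.symm_hom, id_comp, Iso.app_inv]

/-- `shiftedHomQLinearEquiv.symm` unfolded. [cite: Spaltenstein1988, Prop. 1.5] -/
theorem shiftedHomQLinearEquiv_symm_apply {E : Type u} [Category.{v} E] [Abelian E] [Linear 𝕜 E]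
    [HasDerivedCategory.{w} E] (X Y : CochainComplex E ℤ) (k : ℤ)
    (y : DerivedCategory.Q.obj X ⟶ DerivedCategory.Q.obj (Y⟦k⟧)) :
    (shiftedHomQLinearEquiv (𝕜 := 𝕜) X Y k).symm y = y ≫ (DerivedCategory.Q.commShiftIso k).hom.app Y := by
  simp only [shiftedHomQLinearEquiv, Linear.homCongr_symm_apply, Iso.refl_hom, Iso.symm_inv, id_comp, Iso.app_hom]

/-- `IsKInjective.homLinearEquivQ.symm (Q f) = [f]`. [cite: Spaltenstein1988, Prop. 1.5] -/
theorem IsKInjective.homLinearEquivQ_symm_Q_map {E : Type u} [Category.{v} E] [Abelian E] [Linear 𝕜 E]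
    [HasDerivedCategory.{w} E] (X Y : CochainComplex E ℤ) [Y.IsKInjective] (f : X ⟶ Y) :
    (IsKInjective.homLinearEquivQ (𝕜 := 𝕜) X Y).symm (DerivedCategory.Q.map f) =
      (HomotopyCategory.quotient E _).map f := by
  rw [LinearEquiv.symm_apply_eq, IsKInjective.homLinearEquivQ_quotient_map]

/-- **`Ψ (x̃.map Q) = (x̃♭).map Q`**: on the image of a chain-level shifted Hom `x̃ : L M ⟶ J⟦k⟧`, the derived
adjunction equivalence `shiftedHomLinearEquivOfAdjunction` is the transpose along the termwise adjunction
(`ShiftedHom.transpose (mapHomologicalComplexAdj adj _)`) read through `Q`. [cite: Lipman2009, Prop. 3.2.3] -/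
theorem shiftedHomLinearEquivOfAdjunction_map (M : CochainComplex C ℤ) (J : CochainComplex D ℤ) (a : ℤ)
    [J.IsStrictlyGE a] [∀ n, Injective (J.X n)] (k : ℤ)
    (x : ShiftedHom ((L.mapHomologicalComplex (ComplexShape.up ℤ)).obj M) J k) :
    shiftedHomLinearEquivOfAdjunction (𝕜 := 𝕜) adj M J a k (x.map DerivedCategory.Q) =
      (ShiftedHom.transpose (mapHomologicalComplexAdj adj (ComplexShape.up ℤ)) x).map DerivedCategory.Q := by
  haveI : J.IsKInjective := CochainComplex.isKInjective_of_injective J a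
  haveI : CochainComplex.IsKInjective ((R.mapHomologicalComplex (ComplexShape.up ℤ)).obj J) :=
    isKInjective_mapHomologicalComplex_of_injective adj J a
  haveI : CochainComplex.IsKInjective (((R.mapHomologicalComplex (ComplexShape.up ℤ)).obj J)⟦k⟧) :=
    inferInstance
  haveI : CochainComplex.IsKInjective ((R.mapHomologicalComplex (ComplexShape.up ℤ)).obj (J⟦k⟧)) :=
    CochainComplex.isKInjective_of_iso
      (show ((R.mapHomologicalComplex (ComplexShape.up ℤ)).obj J)⟦k⟧ ≅
          (R.mapHomologicalComplex (ComplexShape.up ℤ)).obj (J⟦k⟧) from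
        (((R.mapHomologicalComplex (ComplexShape.up ℤ)).commShiftIso k).app J).symm)
  -- unfold the six steps
  simp only [shiftedHomLinearEquivOfAdjunction, LinearEquiv.trans_apply]
  rw [shiftedHomQLinearEquiv_apply, ShiftedHom.map, assoc, Iso.hom_inv_id_app]
  erw [comp_id]
  rw [IsKInjective.homLinearEquivQ_symm_Q_map, homotopyHomEquivOfAdjunction_quotient_map,
    IsKInjective.homLinearEquivQ_quotient_map]
  erw [Linear.homCongr_apply, shiftedHomQLinearEquiv_symm_apply]
  simp only [ShiftedHom.map, ShiftedHom.transpose, Iso.refl_inv, Functor.mapIso_hom, Iso.app_hom,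
    Functor.map_comp, assoc, id_comp]

/-- **Every derived shifted Hom into `Q J` is a chain-level one**: for `J` bounded-below injective,
`x = x̃.map Q` for some chain map `x̃ : L M ⟶ J⟦k⟧` (`J⟦k⟧` is K-injective; Mathlib
`CochainComplex.IsKInjective.Qh_map_bijective`). [cite: Spaltenstein1988, Prop. 1.5] -/
theorem exists_map_Q_eq {E : Type u'} [Category.{v'} E] [Abelian E] [HasDerivedCategory.{w'} E]
    (X J : CochainComplex E ℤ) (a : ℤ) [J.IsStrictlyGE a] [∀ n, Injective (J.X n)] (k : ℤ)
    (x : ShiftedHom (DerivedCategory.Q.obj X) (DerivedCategory.Q.obj J) k) :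
    ∃ x' : ShiftedHom X J k, x'.map DerivedCategory.Q = x := by
  haveI : J.IsKInjective := CochainComplex.isKInjective_of_injective J a
  let α := DerivedCategory.quotientCompQhIso E
  obtain ⟨φ, hφ⟩ := (CochainComplex.IsKInjective.Qh_map_bijective
    ((HomotopyCategory.quotient E _).obj X) (J⟦k⟧)).2
    (α.hom.app X ≫ x ≫ (DerivedCategory.Q.commShiftIso k).inv.app J ≫ α.inv.app (J⟦k⟧))
  obtain ⟨f, rfl⟩ := (HomotopyCategory.quotient E _).map_surjective φ
  refine ⟨f, ?_⟩
  have hf : DerivedCategory.Q.map f = x ≫ (DerivedCategory.Q.commShiftIso k).inv.app J := by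
    have nat := DerivedCategory.quotientCompQhIso_hom_naturality (C := E) f
    rw [hφ] at nat
    simp only [assoc, Iso.inv_hom_id_app, α] at nat
    erw [comp_id] at nat
    exact ((cancel_epi ((DerivedCategory.quotientCompQhIso E).hom.app X)).1 nat).symm
  rw [ShiftedHom.map, hf, assoc, Iso.inv_hom_id_app]
  erw [comp_id]

/-- **Naturality of `Ψ` in the first variable for chain maps** (node law `adj_mk₀_comp`):
`Ψ ([Q (L f)] · x) = [Q f] · Ψ x`. [cite: Lipman2009, Prop. 3.2.3] [cite: Weibel1994, §10.4] -/
theorem shiftedHomLinearEquivOfAdjunction_mk₀_comp {M M' : CochainComplex C ℤ} (f : M' ⟶ M)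
    (J : CochainComplex D ℤ) (a : ℤ) [J.IsStrictlyGE a] [∀ n, Injective (J.X n)] (k : ℤ)
    (x : ShiftedHom (DerivedCategory.Q.obj ((L.mapHomologicalComplex (ComplexShape.up ℤ)).obj M))
      (DerivedCategory.Q.obj J) k) :
    shiftedHomLinearEquivOfAdjunction (𝕜 := 𝕜) adj M' J a k
        ((ShiftedHom.mk₀ (0 : ℤ) rfl (DerivedCategory.Q.map
          ((L.mapHomologicalComplex (ComplexShape.up ℤ)).map f))).comp x (add_zero k)) =
      (ShiftedHom.mk₀ (0 : ℤ) rfl (DerivedCategory.Q.map f)).comp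
        (shiftedHomLinearEquivOfAdjunction (𝕜 := 𝕜) adj M J a k x) (add_zero k) := by
  obtain ⟨x, rfl⟩ := exists_map_Q_eq _ J a k x
  rw [← ShiftedHom.map_mk₀ (0 : ℤ) rfl _ DerivedCategory.Q, ← ShiftedHom.map_comp,
    shiftedHomLinearEquivOfAdjunction_map, shiftedHomLinearEquivOfAdjunction_map,
    ShiftedHom.transpose_mk₀_comp, ShiftedHom.map_comp, ShiftedHom.map_mk₀]

/-- Naturality of `Ψ` in the first variable, plain form: `Ψ (Q(L f) ≫ x) = Q f ≫ Ψ x`.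
[cite: Lipman2009, Prop. 3.2.3] -/
theorem shiftedHomLinearEquivOfAdjunction_precomp {M M' : CochainComplex C ℤ} (f : M' ⟶ M)
    (J : CochainComplex D ℤ) (a : ℤ) [J.IsStrictlyGE a] [∀ n, Injective (J.X n)] (k : ℤ)
    (x : ShiftedHom (DerivedCategory.Q.obj ((L.mapHomologicalComplex (ComplexShape.up ℤ)).obj M))
      (DerivedCategory.Q.obj J) k) :
    shiftedHomLinearEquivOfAdjunction (𝕜 := 𝕜) adj M' J a k
        (DerivedCategory.Q.map ((L.mapHomologicalComplex (ComplexShape.up ℤ)).map f) ≫ x :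
          ShiftedHom _ (DerivedCategory.Q.obj J) k) =
      DerivedCategory.Q.map f ≫ shiftedHomLinearEquivOfAdjunction (𝕜 := 𝕜) adj M J a k x := by
  have h := shiftedHomLinearEquivOfAdjunction_mk₀_comp (𝕜 := 𝕜) adj f J a k x
  rwa [ShiftedHom.mk₀_comp, ShiftedHom.mk₀_comp] at h

/-- **Counit normalisation of `Ψ`** (node law `adj_counitClass`): `Ψ [Q ε_J] = [𝟙_{Q(R J)}]` for the
termwise counit `ε_J : L(R J) ⟶ J`. [cite: Lipman2009, Prop. 3.2.3] [cite: Weibel1994, §10.4] -/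
theorem shiftedHomLinearEquivOfAdjunction_mk₀_counit (J : CochainComplex D ℤ) (a : ℤ) [J.IsStrictlyGE a]
    [∀ n, Injective (J.X n)] :
    shiftedHomLinearEquivOfAdjunction (𝕜 := 𝕜) adj ((R.mapHomologicalComplex (ComplexShape.up ℤ)).obj J) J a 0
        (ShiftedHom.mk₀ (0 : ℤ) rfl (DerivedCategory.Q.map
          (X := (L.mapHomologicalComplex (ComplexShape.up ℤ)).obj
            ((R.mapHomologicalComplex (ComplexShape.up ℤ)).obj J)) (Y := J)
          ((mapHomologicalComplexAdj adj (ComplexShape.up ℤ)).counit.app J))) =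
      ShiftedHom.mk₀ (0 : ℤ) rfl (𝟙 _) := by
  rw [← ShiftedHom.map_mk₀ (0 : ℤ) rfl _ DerivedCategory.Q, shiftedHomLinearEquivOfAdjunction_map,
    ShiftedHom.transpose_mk₀_counit, ShiftedHom.map_mk₀, DerivedCategory.Q.map_id]

/-- **`Ψ` is multiplicative** (node law `adj_comp`, resolution-free form): for derived classes
`z : Q(L K') ⟶ (Q J)⟦a⟧` and `w : Q J ⟶ (Q J')⟦b⟧` with `J, J'` bounded-below injective,
`Ψ (z · w) = Ψ z · Ψ ([Q ε_J] · w)`. [cite: Lipman2009, Prop. 3.2.3] [cite: Weibel1994, §10.4] -/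
theorem shiftedHomLinearEquivOfAdjunction_comp (K' : CochainComplex C ℤ) (J J' : CochainComplex D ℤ)
    (aJ aJ' : ℤ) [J.IsStrictlyGE aJ] [∀ n, Injective (J.X n)] [J'.IsStrictlyGE aJ'] [∀ n, Injective (J'.X n)]
    {a b c : ℤ} (z : ShiftedHom (DerivedCategory.Q.obj ((L.mapHomologicalComplex (ComplexShape.up ℤ)).obj K'))
      (DerivedCategory.Q.obj J) a)
    (w : ShiftedHom (DerivedCategory.Q.obj J) (DerivedCategory.Q.obj J') b) (h : b + a = c) :
    shiftedHomLinearEquivOfAdjunction (𝕜 := 𝕜) adj K' J' aJ' c (z.comp w h) =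
      (shiftedHomLinearEquivOfAdjunction (𝕜 := 𝕜) adj K' J aJ a z).comp
        (shiftedHomLinearEquivOfAdjunction (𝕜 := 𝕜) adj ((R.mapHomologicalComplex (ComplexShape.up ℤ)).obj J) J'
          aJ' b ((ShiftedHom.mk₀ (0 : ℤ) rfl (DerivedCategory.Q.map
            (X := (L.mapHomologicalComplex (ComplexShape.up ℤ)).obj
              ((R.mapHomologicalComplex (ComplexShape.up ℤ)).obj J)) (Y := J)
            ((mapHomologicalComplexAdj adj (ComplexShape.up ℤ)).counit.app J))).comp w (add_zero b))) h := by
  obtain ⟨z, rfl⟩ := exists_map_Q_eq _ J aJ a z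
  obtain ⟨w, rfl⟩ := exists_map_Q_eq _ J' aJ' b w
  rw [← ShiftedHom.map_comp, shiftedHomLinearEquivOfAdjunction_map, ShiftedHom.transpose_comp,
    ShiftedHom.map_comp, ← shiftedHomLinearEquivOfAdjunction_map (𝕜 := 𝕜) adj K' J aJ,
    ← shiftedHomLinearEquivOfAdjunction_map (𝕜 := 𝕜) adj _ J' aJ', ShiftedHom.map_comp, ShiftedHom.map_mk₀]

/-! ### The same laws after transport along resolutions (`shiftedHomLinearEquivOfAdjunctionOfQuasiIso`) -/

/-- **`Φ x = Ψ (x ≫ (Q ι)⟦k⟧) ≫ (Q (R ι))⁻¹⟦k⟧`** — the resolution-transported equivalence unfolded.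
[cite: Lipman2009, Prop. 3.2.3 and Cor. 3.2.4] -/
theorem shiftedHomLinearEquivOfAdjunctionOfQuasiIso_eq (M : CochainComplex C ℤ) {E I : CochainComplex D ℤ}
    (ι : E ⟶ I) [QuasiIso ι] (a : ℤ) [I.IsStrictlyGE a] [∀ n, Injective (I.X n)]
    (hR : QuasiIso ((R.mapHomologicalComplex (ComplexShape.up ℤ)).map ι)) (k : ℤ)
    (x : ShiftedHom (DerivedCategory.Q.obj ((L.mapHomologicalComplex (ComplexShape.up ℤ)).obj M))
      (DerivedCategory.Q.obj E) k) :
    haveI : IsIso (DerivedCategory.Q.map ((R.mapHomologicalComplex (ComplexShape.up ℤ)).map ι)) := by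
      rw [DerivedCategory.isIso_Q_map_iff_quasiIso]; exact hR
    shiftedHomLinearEquivOfAdjunctionOfQuasiIso (𝕜 := 𝕜) adj M ι a hR k x =
      shiftedHomLinearEquivOfAdjunction (𝕜 := 𝕜) adj M I a k
          (x ≫ (DerivedCategory.Q.map ι)⟦k⟧' : ShiftedHom _ (DerivedCategory.Q.obj I) k) ≫
        (inv (DerivedCategory.Q.map ((R.mapHomologicalComplex (ComplexShape.up ℤ)).map ι)))⟦k⟧' := by
  simp only [shiftedHomLinearEquivOfAdjunctionOfQuasiIso, LinearEquiv.trans_apply, Linear.homCongr_apply,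
    Linear.homCongr_symm_apply, Iso.refl_inv, Iso.refl_hom, id_comp, Functor.mapIso_hom, Functor.mapIso_inv,
    asIso_hom, asIso_inv]

variable {M M' K' : CochainComplex C ℤ}

/-- **Naturality in the first variable for chain maps** (node law `adj_mk₀_comp`) for the
resolution-transported equivalence `Φ`. [cite: Lipman2009, Prop. 3.2.3] [cite: Weibel1994, §10.4] -/
theorem shiftedHomLinearEquivOfAdjunctionOfQuasiIso_mk₀_comp (f : M' ⟶ M) {E I : CochainComplex D ℤ}
    (ι : E ⟶ I) [QuasiIso ι] (a : ℤ) [I.IsStrictlyGE a] [∀ n, Injective (I.X n)]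
    (hR : QuasiIso ((R.mapHomologicalComplex (ComplexShape.up ℤ)).map ι)) (k : ℤ)
    (x : ShiftedHom (DerivedCategory.Q.obj ((L.mapHomologicalComplex (ComplexShape.up ℤ)).obj M))
      (DerivedCategory.Q.obj E) k) :
    shiftedHomLinearEquivOfAdjunctionOfQuasiIso (𝕜 := 𝕜) adj M' ι a hR k
        ((ShiftedHom.mk₀ (0 : ℤ) rfl (DerivedCategory.Q.map
          ((L.mapHomologicalComplex (ComplexShape.up ℤ)).map f))).comp x (add_zero k)) =
      (ShiftedHom.mk₀ (0 : ℤ) rfl (DerivedCategory.Q.map f)).comp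
        (shiftedHomLinearEquivOfAdjunctionOfQuasiIso (𝕜 := 𝕜) adj M ι a hR k x) (add_zero k) := by
  rw [shiftedHomLinearEquivOfAdjunctionOfQuasiIso_eq, shiftedHomLinearEquivOfAdjunctionOfQuasiIso_eq,
    ShiftedHom.mk₀_comp, ShiftedHom.mk₀_comp, assoc]
  have h := shiftedHomLinearEquivOfAdjunction_mk₀_comp (𝕜 := 𝕜) adj f I a k
    (x ≫ (DerivedCategory.Q.map ι)⟦k⟧' : ShiftedHom _ (DerivedCategory.Q.obj I) k)
  rw [ShiftedHom.mk₀_comp, ShiftedHom.mk₀_comp] at h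
  rw [h, assoc]

/-- **Counit normalisation** (node law `adj_counitClass`) for `Φ`: `Φ [Q ε_E] = [𝟙_{Q(R E)}]`.
[cite: Lipman2009, Prop. 3.2.3] [cite: Weibel1994, §10.4] -/
theorem shiftedHomLinearEquivOfAdjunctionOfQuasiIso_mk₀_counit {E I : CochainComplex D ℤ}
    (ι : E ⟶ I) [QuasiIso ι] (a : ℤ) [I.IsStrictlyGE a] [∀ n, Injective (I.X n)]
    (hR : QuasiIso ((R.mapHomologicalComplex (ComplexShape.up ℤ)).map ι)) :
    shiftedHomLinearEquivOfAdjunctionOfQuasiIso (𝕜 := 𝕜) adj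
        ((R.mapHomologicalComplex (ComplexShape.up ℤ)).obj E) ι a hR 0
        (ShiftedHom.mk₀ (0 : ℤ) rfl (DerivedCategory.Q.map
          (X := (L.mapHomologicalComplex (ComplexShape.up ℤ)).obj
            ((R.mapHomologicalComplex (ComplexShape.up ℤ)).obj E)) (Y := E)
          ((mapHomologicalComplexAdj adj (ComplexShape.up ℤ)).counit.app E))) =
      ShiftedHom.mk₀ (0 : ℤ) rfl (𝟙 _) := by
  haveI : IsIso (DerivedCategory.Q.map ((R.mapHomologicalComplex (ComplexShape.up ℤ)).map ι)) := by
    rw [DerivedCategory.isIso_Q_map_iff_quasiIso]; exact hR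
  have hnat : (mapHomologicalComplexAdj adj (ComplexShape.up ℤ)).counit.app E ≫ ι =
      (L.mapHomologicalComplex (ComplexShape.up ℤ)).map ((R.mapHomologicalComplex (ComplexShape.up ℤ)).map ι) ≫
        (mapHomologicalComplexAdj adj (ComplexShape.up ℤ)).counit.app I :=
    ((mapHomologicalComplexAdj adj (ComplexShape.up ℤ)).counit.naturality ι).symm
  rw [shiftedHomLinearEquivOfAdjunctionOfQuasiIso_eq, ShiftedHom.mk₀_comp_shift_map, ← DerivedCategory.Q.map_comp,
    hnat, DerivedCategory.Q.map_comp, ShiftedHom.mk₀_precomp, shiftedHomLinearEquivOfAdjunction_precomp,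
    shiftedHomLinearEquivOfAdjunction_mk₀_counit, ← ShiftedHom.mk₀_precomp, comp_id,
    ShiftedHom.mk₀_comp_shift_map, IsIso.hom_inv_id]

/-- **Multiplicativity** (node law `adj_comp`) for `Φ`, with resolutions `ι_K : K ⟶ I_K`, `ι_L : L ⟶ I_L` of
both second variables: `Φ_L (z · y) = Φ_K z · Φ_L ([Q ε_K] · y)` for derived classes
`z : Q(L K') ⟶ (Q K)⟦a⟧`, `y : Q K ⟶ (Q L)⟦b⟧`. [cite: Lipman2009, Prop. 3.2.3] [cite: Weibel1994, §10.4] -/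
theorem shiftedHomLinearEquivOfAdjunctionOfQuasiIso_comp {K IK N IN : CochainComplex D ℤ}
    (ιK : K ⟶ IK) [QuasiIso ιK] (aK : ℤ) [IK.IsStrictlyGE aK] [∀ n, Injective (IK.X n)]
    (hRK : QuasiIso ((R.mapHomologicalComplex (ComplexShape.up ℤ)).map ιK))
    (ιL : N ⟶ IN) [QuasiIso ιL] (aL : ℤ) [IN.IsStrictlyGE aL] [∀ n, Injective (IN.X n)]
    (hRL : QuasiIso ((R.mapHomologicalComplex (ComplexShape.up ℤ)).map ιL))
    {a b c : ℤ} (z : ShiftedHom (DerivedCategory.Q.obj ((L.mapHomologicalComplex (ComplexShape.up ℤ)).obj K'))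
      (DerivedCategory.Q.obj K) a)
    (y : ShiftedHom (DerivedCategory.Q.obj K) (DerivedCategory.Q.obj N) b) (h : b + a = c) :
    shiftedHomLinearEquivOfAdjunctionOfQuasiIso (𝕜 := 𝕜) adj K' ιL aL hRL c (z.comp y h) =
      (shiftedHomLinearEquivOfAdjunctionOfQuasiIso (𝕜 := 𝕜) adj K' ιK aK hRK a z).comp
        (shiftedHomLinearEquivOfAdjunctionOfQuasiIso (𝕜 := 𝕜) adj
          ((R.mapHomologicalComplex (ComplexShape.up ℤ)).obj K) ιL aL hRL b
          ((ShiftedHom.mk₀ (0 : ℤ) rfl (DerivedCategory.Q.map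
            (X := (L.mapHomologicalComplex (ComplexShape.up ℤ)).obj
              ((R.mapHomologicalComplex (ComplexShape.up ℤ)).obj K)) (Y := K)
            ((mapHomologicalComplexAdj adj (ComplexShape.up ℤ)).counit.app K))).comp y (add_zero b))) h := by
  haveI : IsIso (DerivedCategory.Q.map ιK) := by
    rw [DerivedCategory.isIso_Q_map_iff_quasiIso]; infer_instance
  haveI : IsIso (DerivedCategory.Q.map ((R.mapHomologicalComplex (ComplexShape.up ℤ)).map ιK)) := by
    rw [DerivedCategory.isIso_Q_map_iff_quasiIso]; exact hRK
  haveI : IsIso (DerivedCategory.Q.map ((R.mapHomologicalComplex (ComplexShape.up ℤ)).map ιL)) := by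
    rw [DerivedCategory.isIso_Q_map_iff_quasiIso]; exact hRL
  -- the derived class `yt : Q I_K ⟶ (Q I_L)⟦b⟧` representing `y` on the resolutions
  set yt : ShiftedHom (DerivedCategory.Q.obj IK) (DerivedCategory.Q.obj IN) b :=
    inv (DerivedCategory.Q.map ιK) ≫ y ≫ (DerivedCategory.Q.map ιL)⟦b⟧' with hyt
  have hy : (y ≫ (DerivedCategory.Q.map ιL)⟦b⟧' : ShiftedHom _ (DerivedCategory.Q.obj IN) b) =
      DerivedCategory.Q.map ιK ≫ yt := by
    rw [hyt, IsIso.hom_inv_id_assoc]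
  rw [shiftedHomLinearEquivOfAdjunctionOfQuasiIso_eq, shiftedHomLinearEquivOfAdjunctionOfQuasiIso_eq,
    shiftedHomLinearEquivOfAdjunctionOfQuasiIso_eq, ← ShiftedHom.comp_postcomp, hy,
    ← ShiftedHom.comp_shift_comp, shiftedHomLinearEquivOfAdjunction_comp (𝕜 := 𝕜) adj K' IK IN aK aL,
    ShiftedHom.mk₀_comp, ShiftedHom.mk₀_comp, assoc]
  -- `[Q ε_K] ≫ Q ι_K ≫ yt = Q(L R ι_K) ≫ [Q ε_{I_K}] ≫ yt`
  have hnat : DerivedCategory.Q.map ((mapHomologicalComplexAdj adj (ComplexShape.up ℤ)).counit.app K) ≫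
      DerivedCategory.Q.map ιK =
      DerivedCategory.Q.map ((L.mapHomologicalComplex (ComplexShape.up ℤ)).map
        ((R.mapHomologicalComplex (ComplexShape.up ℤ)).map ιK)) ≫
      DerivedCategory.Q.map ((mapHomologicalComplexAdj adj (ComplexShape.up ℤ)).counit.app IK) := by
    rw [← DerivedCategory.Q.map_comp, ← DerivedCategory.Q.map_comp]
    exact congrArg _ ((mapHomologicalComplexAdj adj (ComplexShape.up ℤ)).counit.naturality ιK).symm
  rw [hy, ← assoc (DerivedCategory.Q.map _) (DerivedCategory.Q.map ιK) yt, hnat, assoc]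
  have h1 := shiftedHomLinearEquivOfAdjunction_mk₀_comp (𝕜 := 𝕜) adj
    ((R.mapHomologicalComplex (ComplexShape.up ℤ)).map ιK) IN aL b
    (DerivedCategory.Q.map ((mapHomologicalComplexAdj adj (ComplexShape.up ℤ)).counit.app IK) ≫ yt :
      ShiftedHom _ (DerivedCategory.Q.obj IN) b)
  rw [ShiftedHom.mk₀_comp, ShiftedHom.mk₀_comp] at h1
  rw [h1, ShiftedHom.comp_postcomp, ShiftedHom.comp_shift_comp, IsIso.inv_hom_id_assoc]

end KInjective

end Literature.Algebra.Homology

end
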